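import Summits.KontsevichZagierPeriods.KontsevichZagierPeriods.Theorems.IsogenyCertificatesXMapKernelStubUnboundedToEgg
import Summits.KontsevichZagierPeriods.KontsevichZagierPeriods.Theorems.IsogenyCertificatesOneSheetTransfer
import Literature.NumberTheory.Transcendental.KZLogCalculusProofs

/-!
# `BiellipticRealPeriodCell` (stmt-KontsevichZagierPeriods-18685), line `Sketch` — stub `stub_componentLanding`

For a nonsingular integral cubic `P = x³ + Ax + B` (`4A³ + 27B² ≠ 0`) write `S = {P > 0}`,
`U = connectedComponentIn S (1 + |A| + |B|)` (the unbounded component of `S`) and `E = S ∖ U` (the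
egg; empty unless `4A³ + 27B² < 0`). The stub (label DE of the line): a representation
`[(c, d), a/√P]` on a whole bounded component of `S` (`c < d` roots of `P`, `P > 0` between them), or
`[(c, ∞), a/√P]` on a whole ray from a root `c` on which `P > 0`, is congruent modulo `KZ.relations`
to an element of the subgroup generated by the cell-(i) generators `[S, a'/√P]` — in fact to ONE
generator.

Proof. By `XMapPeriodTransferCells.stub_cubicComponents`, `(c, ∞) = U` and `(c, d) = E`.
* If `4A³ + 27B² > 0` the cubic has exactly one real root (`OneSheetTransfer.cubic_eq_zero_iff`, so
  the bounded clause is vacuous) and `S = (c, ∞)` (`OneSheetTransfer.cubic_pos_iff`): the ray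
  representation is itself a generator.
* If `4A³ + 27B² < 0`, let `k ≥ 1` be the multiplier of `XMapKernelStubs.UnboundedToEgg.stub_unboundedToEgg`
  (`[E, s/√P] ∼ [U, (k s/2)/√P]` for every `s : ℚ`). For `q := 2a/(2 + k)` the moves give, modulo
  `KZ.relations`, `[U, a] ≡ [U, q] + [U, k q/2]` (rule (1b), `q + k q/2 = a`) `≡ [U, q] + [E, q]`
  (egg transfer) `≡ [S, q]` (rule (1a), `S = U ⊔ E`) — this lands the ray (`unbounded_to_full`); the
  egg `[E, a] ∼ [U, k a/2]` is then landed by the same lemma.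
Integrability of `dx/√P` on `S` is inherited from the sector representation
`XMapKernelStubs.SectorRepsExist.stub_sectorRepsExist`; the representations `[D, s/√P]` are
`XMapPeriodTransferCells.exists_rep`. No definitions are introduced (all sets written out).

References: M. Kontsevich, D. Zagier, *Periods* (2001), §1.2 (rules (1), (2)).
-/

noncomputable section

open Polynomial Set MeasureTheory
open Literature.NumberTheory.Transcendental
open Literature.ModelTheory.ExponentialFields (IsSemialgebraic)
open Summit.KontsevichZagierPeriods.IsogenyCertificates.XMapPeriodTransferCells

namespace Summit.KontsevichZagierPeriods.IsogenyCertificates.BiellipticRealPeriodCellStubs.ComponentLanding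

/-! ### From the unbounded component to the full positivity set -/

/-- Integrability of `dx/√P` on `{P > 0}`, inherited from the sector representation
`SectorRepsExist.stub_sectorRepsExist` (`a = 1`). [folklore] -/
private theorem integrableOn_inv_sqrt (A B : ℤ) (hΔ : 4 * A ^ 3 + 27 * B ^ 2 ≠ 0) :
    IntegrableOn (fun x : Fin 1 → ℝ => 1 / Real.sqrt (x 0 ^ 3 + (A : ℝ) * x 0 + (B : ℝ)))
      {x : Fin 1 → ℝ | 0 < x 0 ^ 3 + (A : ℝ) * x 0 + (B : ℝ)} := by
  obtain ⟨r₁, hr₁d, hr₁i⟩ := XMapKernelStubs.SectorRepsExist.stub_sectorRepsExist A B 1 hΔ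
  exact XMapPeriodTransferValue.integrableOn_of_rep (a := 1) r₁ hr₁d
    (by rw [hr₁i]; exact fun _ _ => rfl) one_ne_zero

/-- **From the unbounded component to the full positivity set.** For a three-real-root integral cubic
(`4A³ + 27B² < 0`) and `a : ℚ`, every representation `[U, a/√P]` on the unbounded component `U` of
`S = {P > 0}` is congruent modulo `KZ.relations` to a representation `[S, q/√P]` on the full
positivity set, `q = 2a/(2 + k)` with `k` the multiplier of `stub_unboundedToEgg`:
`[U, a] ≡ [U, q] + [U, k q/2] ≡ [U, q] + [E, q] ≡ [S, q]` (rule (1b), egg transfer, rule (1a)).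
[cite: KontsevichZagier2001, §1.2] -/
private theorem unbounded_to_full (A B : ℤ) (hΔ : 4 * A ^ 3 + 27 * B ^ 2 < 0) (a : ℚ)
    (u : KZ.IntegralRep 1)
    (hud : u.domain = {x | x 0 ∈ connectedComponentIn {y : ℝ | 0 < y ^ 3 + (A : ℝ) * y + (B : ℝ)}
      (1 + |(A : ℝ)| + |(B : ℝ)|)})
    (hui : EqOn u.integrand (fun x => (a : ℝ) / Real.sqrt (x 0 ^ 3 + (A : ℝ) * x 0 + (B : ℝ)))
      u.domain) :
    ∃ (q : ℚ) (ρ : KZ.IntegralRep 1), ρ.domain = {x | 0 < x 0 ^ 3 + (A : ℝ) * x 0 + (B : ℝ)} ∧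
      EqOn ρ.integrand (fun x => (q : ℝ) / Real.sqrt (x 0 ^ 3 + (A : ℝ) * x 0 + (B : ℝ))) ρ.domain ∧
      KZ.of u - KZ.of ρ ∈ KZ.relations := by
  have hΔ0 : 4 * A ^ 3 + 27 * B ^ 2 ≠ 0 := hΔ.ne
  have hint := integrableOn_inv_sqrt A B hΔ0
  obtain ⟨k, -, hke⟩ := XMapKernelStubs.UnboundedToEgg.stub_unboundedToEgg A B hΔ
  -- the coefficient `q = 2a/(2 + k)`, so that `q + k q/2 = a`
  obtain ⟨q, hq⟩ : ∃ q : ℚ, q = 2 * a / (2 + (k : ℚ)) := ⟨_, rfl⟩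
  have hsum : (q : ℝ) + (((k : ℚ) * q / 2 : ℚ) : ℝ) = (a : ℝ) := by
    have h2k : (2 + (k : ℝ)) ≠ 0 := by positivity
    rw [hq]
    push_cast
    field_simp
  have hUS : connectedComponentIn {y : ℝ | 0 < y ^ 3 + (A : ℝ) * y + (B : ℝ)} (1 + |(A : ℝ)| + |(B : ℝ)|) ⊆
      {y : ℝ | 0 < y ^ 3 + (A : ℝ) * y + (B : ℝ)} := connectedComponentIn_subset _ _
  have hUsub : {x : Fin 1 → ℝ | x 0 ∈ connectedComponentIn {y : ℝ | 0 < y ^ 3 + (A : ℝ) * y + (B : ℝ)}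
      (1 + |(A : ℝ)| + |(B : ℝ)|)} ⊆ {x : Fin 1 → ℝ | 0 < x 0 ^ 3 + (A : ℝ) * x 0 + (B : ℝ)} :=
    fun x hx => hUS hx
  have hEsub : {x : Fin 1 → ℝ | x 0 ∈ {y : ℝ | 0 < y ^ 3 + (A : ℝ) * y + (B : ℝ)} \
      connectedComponentIn {y : ℝ | 0 < y ^ 3 + (A : ℝ) * y + (B : ℝ)} (1 + |(A : ℝ)| + |(B : ℝ)|)} ⊆
      {x : Fin 1 → ℝ | 0 < x 0 ^ 3 + (A : ℝ) * x 0 + (B : ℝ)} :=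
    fun x hx => hx.1
  -- the representations `[S, q]`, `[U, q]`, `[E, q]`, `[U, k q/2]`
  obtain ⟨ρ, hρd, hρi⟩ := exists_rep A B q (D := {x : Fin 1 → ℝ | 0 < x 0 ^ 3 + (A : ℝ) * x 0 + (B : ℝ)})
    (isSemialgebraic_hat_cubic_pos A B) Subset.rfl hint
  obtain ⟨u₁, hu₁d, hu₁i⟩ := exists_rep A B q (isSemialgebraic_hat_unbounded A B) hUsub hint
  obtain ⟨e₁, he₁d, he₁i⟩ := exists_rep A B q (isSemialgebraic_hat_egg A B) hEsub hint
  obtain ⟨u₂, hu₂d, hu₂i⟩ :=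
    exists_rep A B ((k : ℚ) * q / 2) (isSemialgebraic_hat_unbounded A B) hUsub hint
  -- rule (1a): `[S, q] − [U, q] − [E, q] ∈ relations` (`S = U ⊔ E`)
  have h1a : KZ.of ρ - KZ.of u₁ - KZ.of e₁ ∈ KZ.relations := by
    refine KZ.domainAddRel_subset_relations ⟨1, ρ, u₁, e₁, ?_, ?_, fun x _ => by rw [hρi, hu₁i],
      fun x _ => by rw [hρi, he₁i], rfl⟩
    · rw [hρd, hu₁d, he₁d]
      ext x
      refine ⟨fun hx => ?_, ?_⟩
      · by_cases hxU : x 0 ∈ connectedComponentIn {y : ℝ | 0 < y ^ 3 + (A : ℝ) * y + (B : ℝ)}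
            (1 + |(A : ℝ)| + |(B : ℝ)|)
        · exact Or.inl hxU
        · exact Or.inr ⟨hx, hxU⟩
      · rintro (hxU | hxE)
        · exact hUS hxU
        · exact hxE.1
    · rw [hu₁d, he₁d]
      exact measure_mono_null (fun x hx => (hx.2.2 hx.1).elim) measure_empty
  -- egg transfer: `[E, q] − [U, k q/2] ∈ relations`
  have hegg : KZ.of e₁ - KZ.of u₂ ∈ KZ.relations :=
    hke q e₁ u₂ he₁d (by rw [he₁i]; exact fun _ _ => rfl) hu₂d (by rw [hu₂i]; exact fun _ _ => rfl)
  -- rule (1b): `[U, a] − [U, q] − [U, k q/2] ∈ relations` (`a = q + k q/2`)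
  have h1b : KZ.of u - KZ.of u₁ - KZ.of u₂ ∈ KZ.relations := by
    refine KZ.integrandAddRel_subset_relations ⟨1, u, u₁, u₂, hu₁d.trans hud.symm,
      hu₂d.trans hud.symm, fun x hx => ?_, rfl⟩
    rw [hui hx]
    simp only [Pi.add_apply, hu₁i, hu₂i]
    rw [← add_div, hsum]
  refine ⟨q, ρ, hρd, by rw [hρi]; exact fun _ _ => rfl, ?_⟩
  have : KZ.of u - KZ.of ρ = (KZ.of u - KZ.of u₁ - KZ.of u₂) - (KZ.of ρ - KZ.of u₁ - KZ.of e₁) -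
      (KZ.of e₁ - KZ.of u₂) := by abel
  rw [this]
  exact KZ.relations.sub_mem (KZ.relations.sub_mem h1b h1a) hegg

/-- A representation congruent modulo `KZ.relations` to a cell-(i) generator `[S, q/√P]` differs by a
relation from an element of the subgroup generated by the cell-(i) generators. [folklore] -/
private theorem landing_of_generator {A B : ℤ} (hΔ : 4 * A ^ 3 + 27 * B ^ 2 ≠ 0) (q : ℚ)
    (t ρ : KZ.IntegralRep 1) (hρd : ρ.domain = {x | 0 < x 0 ^ 3 + (A : ℝ) * x 0 + (B : ℝ)})
    (hρi : EqOn ρ.integrand (fun x => (q : ℝ) / Real.sqrt (x 0 ^ 3 + (A : ℝ) * x 0 + (B : ℝ))) ρ.domain)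
    (hrel : KZ.of t - KZ.of ρ ∈ KZ.relations) :
    ∃ e ∈ AddSubgroup.closure {d : KZ.FormalRep | ∃ (A B : ℤ) (a : ℚ) (r : KZ.IntegralRep 1),
        4 * A ^ 3 + 27 * B ^ 2 ≠ 0 ∧ r.domain = {x | 0 < x 0 ^ 3 + (A : ℝ) * x 0 + (B : ℝ)} ∧
        Set.EqOn r.integrand (fun x => (a : ℝ) / Real.sqrt (x 0 ^ 3 + (A : ℝ) * x 0 + (B : ℝ))) r.domain ∧
        d = KZ.of r},
      KZ.of t - e ∈ KZ.relations :=
  ⟨KZ.of ρ, AddSubgroup.subset_closure ⟨A, B, q, ρ, hΔ, hρd, hρi, rfl⟩, hrel⟩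

/-! ### The stub -/

/-- **Registered stub `stub_componentLanding`** (label DE) of the line `Sketch`: landing of
whole-component representations in the real-period cell (i). For a nonsingular integral
`P = t³ + At + B`: a representation `[(c,d), a/√P]` on a bounded interval between two roots on which
`P > 0` (the egg `E`), or `[(c,∞), a/√P]` on a ray from a root on which `P > 0` (the unbounded
component `U`), is congruent modulo `KZ.relations` to a `ℤ`-combination (indeed to one) of the
cell-(i) generators `[{P > 0}, a'/√P]`: `(c, d) = E`, `(c, ∞) = U` by `stub_cubicComponents`; for
`4A³ + 27B² > 0` the ray representation is itself a generator (`S = (c, ∞)`), for `4A³ + 27B² < 0`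
`[E, a] ∼ [U, k a/2]` (`stub_unboundedToEgg`) and `[U, a'] ≡ [S, 2a'/(2 + k)]` (`unbounded_to_full`).
[cite: KontsevichZagier2001, §1.2] -/
theorem stub_componentLanding :
    (∀ (A B : ℤ) (a : ℚ) (c d : ℝ) (t : KZ.IntegralRep 1), 4 * A ^ 3 + 27 * B ^ 2 ≠ 0 → c < d →
      c ^ 3 + (A : ℝ) * c + (B : ℝ) = 0 → d ^ 3 + (A : ℝ) * d + (B : ℝ) = 0 →
      (∀ y ∈ Ioo c d, 0 < y ^ 3 + (A : ℝ) * y + (B : ℝ)) →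
      t.domain = {x | x 0 ∈ Ioo c d} →
      EqOn t.integrand (fun x => (a : ℝ) / Real.sqrt (x 0 ^ 3 + (A : ℝ) * x 0 + (B : ℝ))) t.domain →
      ∃ e ∈ AddSubgroup.closure {d : KZ.FormalRep | ∃ (A B : ℤ) (a : ℚ) (r : KZ.IntegralRep 1),
          4 * A ^ 3 + 27 * B ^ 2 ≠ 0 ∧ r.domain = {x | 0 < x 0 ^ 3 + (A : ℝ) * x 0 + (B : ℝ)} ∧
          Set.EqOn r.integrand (fun x => (a : ℝ) / Real.sqrt (x 0 ^ 3 + (A : ℝ) * x 0 + (B : ℝ))) r.domain ∧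
          d = KZ.of r},
        KZ.of t - e ∈ KZ.relations) ∧
    (∀ (A B : ℤ) (a : ℚ) (c : ℝ) (t : KZ.IntegralRep 1), 4 * A ^ 3 + 27 * B ^ 2 ≠ 0 →
      c ^ 3 + (A : ℝ) * c + (B : ℝ) = 0 → (∀ y ∈ Ioi c, 0 < y ^ 3 + (A : ℝ) * y + (B : ℝ)) →
      t.domain = {x | x 0 ∈ Ioi c} →
      EqOn t.integrand (fun x => (a : ℝ) / Real.sqrt (x 0 ^ 3 + (A : ℝ) * x 0 + (B : ℝ))) t.domain →
      ∃ e ∈ AddSubgroup.closure {d : KZ.FormalRep | ∃ (A B : ℤ) (a : ℚ) (r : KZ.IntegralRep 1),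
          4 * A ^ 3 + 27 * B ^ 2 ≠ 0 ∧ r.domain = {x | 0 < x 0 ^ 3 + (A : ℝ) * x 0 + (B : ℝ)} ∧
          Set.EqOn r.integrand (fun x => (a : ℝ) / Real.sqrt (x 0 ^ 3 + (A : ℝ) * x 0 + (B : ℝ))) r.domain ∧
          d = KZ.of r},
        KZ.of t - e ∈ KZ.relations) := by
  refine ⟨fun A B a c d t hΔ hcd hc hd hpos ht hte => ?_, fun A B a c t hΔ hc hpos ht hte => ?_⟩
  · -- bounded component: two distinct real roots force `4A³ + 27B² < 0`, and `(c, d)` is the egg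
    have hneg : 4 * A ^ 3 + 27 * B ^ 2 < 0 := by
      refine hΔ.lt_or_gt.resolve_right fun hposΔ => ?_
      have hΔR : (0 : ℝ) < 4 * (A : ℝ) ^ 3 + 27 * (B : ℝ) ^ 2 := by exact_mod_cast hposΔ
      have hdc : d = c := (OneSheetTransfer.cubic_eq_zero_iff hc hΔR d).1 hd
      linarith
    obtain ⟨k, -, hke⟩ := XMapKernelStubs.UnboundedToEgg.stub_unboundedToEgg A B hneg
    have hegg : Ioo c d = {y : ℝ | 0 < y ^ 3 + (A : ℝ) * y + (B : ℝ)} \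
        connectedComponentIn {y : ℝ | 0 < y ^ 3 + (A : ℝ) * y + (B : ℝ)} (1 + |(A : ℝ)| + |(B : ℝ)|) :=
      (stub_cubicComponents A B hΔ _ rfl c hc).2 d hd hcd fun y hy => hpos y hy
    rw [hegg] at ht
    have hUsub : {x : Fin 1 → ℝ | x 0 ∈ connectedComponentIn {y : ℝ | 0 < y ^ 3 + (A : ℝ) * y + (B : ℝ)}
        (1 + |(A : ℝ)| + |(B : ℝ)|)} ⊆ {x : Fin 1 → ℝ | 0 < x 0 ^ 3 + (A : ℝ) * x 0 + (B : ℝ)} :=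
      fun x hx => (connectedComponentIn_subset {y : ℝ | 0 < y ^ 3 + (A : ℝ) * y + (B : ℝ)}
        (1 + |(A : ℝ)| + |(B : ℝ)|)) hx
    -- `[E, a] ∼ [U, k a/2]`, then `[U, k a/2] ≡ [S, q]`
    obtain ⟨u, hud, hui⟩ := exists_rep A B ((k : ℚ) * a / 2) (isSemialgebraic_hat_unbounded A B) hUsub
      (integrableOn_inv_sqrt A B hΔ)
    have htu : KZ.of t - KZ.of u ∈ KZ.relations :=
      hke a t u ht hte hud (by rw [hui]; exact fun _ _ => rfl)
    obtain ⟨q, ρ, hρd, hρi, huρ⟩ :=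
      unbounded_to_full A B hneg _ u hud (by rw [hui]; exact fun _ _ => rfl)
    refine landing_of_generator hΔ q t ρ hρd hρi ?_
    have : KZ.of t - KZ.of ρ = (KZ.of t - KZ.of u) + (KZ.of u - KZ.of ρ) := by abel
    rw [this]
    exact KZ.relations.add_mem htu huρ
  · -- ray from a root: `(c, ∞)` is the unbounded component
    rcases hΔ.lt_or_gt with hneg | hposΔ
    · have hIoiU : Ioi c = connectedComponentIn {y : ℝ | 0 < y ^ 3 + (A : ℝ) * y + (B : ℝ)}
          (1 + |(A : ℝ)| + |(B : ℝ)|) :=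
        (stub_cubicComponents A B hΔ _ rfl c hc).1 fun y hy => hpos y hy
      rw [hIoiU] at ht
      obtain ⟨q, ρ, hρd, hρi, hrel⟩ := unbounded_to_full A B hneg a t ht hte
      exact landing_of_generator hΔ q t ρ hρd hρi hrel
    · -- one real root: `{P > 0} = (c, ∞)`, so `t` is itself a generator
      have hΔR : (0 : ℝ) < 4 * (A : ℝ) ^ 3 + 27 * (B : ℝ) ^ 2 := by exact_mod_cast hposΔ
      have htd : t.domain = {x | 0 < x 0 ^ 3 + (A : ℝ) * x 0 + (B : ℝ)} := by
        rw [ht]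
        ext x
        simp only [mem_setOf_eq, mem_Ioi]
        exact (OneSheetTransfer.cubic_pos_iff hc hΔR (x 0)).symm
      refine landing_of_generator hΔ a t t htd hte ?_
      rw [sub_self]
      exact KZ.relations.zero_mem

end Summit.KontsevichZagierPeriods.IsogenyCertificates.BiellipticRealPeriodCellStubs.ComponentLanding

end
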